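import Mathlib

/-!
# Crux `DivisionGap.ZeroOneTransfer` (stmt-ValiantsHypothesis-5066), line `planar-dimer-sign-elimination` —
stub `stub_formulaGridProjection`, support file 1: matching sums on finite vertex sets

The route's grid-dimer polynomial is a sum over fixed-point-free involutions `f` of a vertex set of
`∏_v X (v, f v)` (perfect matchings with doubled dart variables).  This file sets up that MATCHING SUM
`msum D W` for an arbitrary finset `D` of an arbitrary type with dart weights `W : α → α → S` in a
commutative semiring, and proves the handful of identities the gadget calculus of the stub needs:

* `msum_expand` — expansion at a vertex `a` over its partner `u` (the defining recursion of perfect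
  matchings), and its corollaries `msum_isolated`, `msum_forced`, `msum_two`, `msum_pair`;
* `msum_union` — multiplicativity over a disconnected disjoint union;
* `msum_eq_zero_of_odd_card` — parity; `msum_perfect` — a vertex set carrying a forced perfect matching
  of unit weight has matching sum `1` (filler dominoes);
* `msum_map` — invariance under an embedding of the vertex type; `invols_univ` — on a finite type the
  summation range is literally the route's filter `∀ v, f (f v) = v ∧ f v ≠ v`.

Everything is elementary and over an arbitrary commutative semiring (no subtraction).  Why not the
tree's `…Shuffling.ihaf` (item 5067, a sum over `f : V → V` on a `Fintype V`): the gadget calculus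
shrinks and glues VERTEX SETS constantly (expansion removes two vertices; a gadget is a sub-finset of
the infinite ambient `ℕ × ℕ`), painless for finsets of one type and heavy for subtypes; `msum` is
`ihaf` transported to finsets (`invols_univ` recovers the `Fintype` form verbatim). [folklore]
-/

set_option linter.dupNamespace false

namespace Summit.ValiantsHypothesis.ValiantsHypothesis.Theorems.DivisionGapZeroOneTransfer

namespace FormulaGridProjection

open Finset

variable {α : Type*} [DecidableEq α]

/-- Extension by the identity of a self-map of a finset (coerced to a type). [folklore] -/
def extFun (D : Finset α) (g : D → D) : α → α := fun x => if h : x ∈ D then (g ⟨x, h⟩ : α) else x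

/-- `extFun D g` agrees with `g` on `D`. [folklore] -/
theorem extFun_apply_mem (D : Finset α) (g : D → D) {x : α} (hx : x ∈ D) :
    extFun D g x = g ⟨x, hx⟩ := by
  simp [extFun, hx]

/-- `extFun D g` is the identity off `D`. [folklore] -/
theorem extFun_apply_not_mem (D : Finset α) (g : D → D) {x : α} (hx : x ∉ D) :
    extFun D g x = x := by
  simp [extFun, hx]

/-- Extension by the identity is injective. [folklore] -/
theorem extFun_injective (D : Finset α) : Function.Injective (extFun D) := by
  intro g g' h
  funext x
  apply Subtype.ext
  have := congrFun h x
  rwa [extFun_apply_mem D g x.2, extFun_apply_mem D g' x.2] at this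

/-- The fixed-point-free involutions of a finset `D`, as self-maps of `α` that are the identity off
`D` — the route's encoding of the perfect matchings of a graph on the vertex set `D`. [folklore] -/
def invols (D : Finset α) : Finset (α → α) :=
  ((univ : Finset (D → D)).map ⟨extFun D, extFun_injective D⟩).filter
    fun f => ∀ v ∈ D, f v ≠ v ∧ f (f v) = v

/-- Membership in `invols D`: a fixed-point-free involution of `D`, the identity elsewhere. [folklore] -/
theorem mem_invols {D : Finset α} {f : α → α} :
    f ∈ invols D ↔ (∀ v ∈ D, f v ∈ D ∧ f v ≠ v ∧ f (f v) = v) ∧ ∀ v ∉ D, f v = v := by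
  constructor
  · intro hf
    rw [invols, mem_filter, mem_map] at hf
    obtain ⟨⟨g, -, hg⟩, h2⟩ := hf
    have hg' : extFun D g = f := hg
    refine ⟨fun v hv => ⟨?_, h2 v hv⟩, fun v hv => ?_⟩
    · rw [← hg', extFun_apply_mem D g hv]; exact (g ⟨v, hv⟩).2
    · rw [← hg', extFun_apply_not_mem D g hv]
  · rintro ⟨h1, h2⟩
    rw [invols, mem_filter, mem_map]
    refine ⟨⟨fun v => ⟨f v, (h1 v v.2).1⟩, mem_univ _, ?_⟩, fun v hv => (h1 v hv).2⟩
    simp only [Function.Embedding.coeFn_mk]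
    funext x
    by_cases hx : x ∈ D
    · rw [extFun_apply_mem D _ hx]
    · rw [extFun_apply_not_mem D _ hx, h2 x hx]

/-- On a finite type, `invols univ` is literally the route's summation range. [folklore] -/
theorem invols_univ [Fintype α] :
    invols (univ : Finset α) = univ.filter fun f => ∀ v, f (f v) = v ∧ f v ≠ v := by
  ext f
  rw [mem_invols, mem_filter]
  constructor
  · rintro ⟨h1, -⟩
    exact ⟨mem_univ _, fun v => ⟨(h1 v (mem_univ v)).2.2, (h1 v (mem_univ v)).2.1⟩⟩
  · rintro ⟨-, h⟩
    exact ⟨fun v _ => ⟨mem_univ _, (h v).2, (h v).1⟩, fun v hv => absurd (mem_univ v) hv⟩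

/-- `invols ∅ = {id}`. [folklore] -/
theorem invols_empty : invols (∅ : Finset α) = {id} := by
  ext f
  rw [mem_invols, mem_singleton]
  constructor
  · rintro ⟨-, h2⟩; funext v; exact h2 v (by simp)
  · rintro rfl; exact ⟨fun v hv => absurd hv (by simp), fun v _ => rfl⟩

variable {S : Type*} [CommSemiring S]

/-- The MATCHING SUM of the dart weights `W` on the vertex set `D`: the sum over fixed-point-free
involutions `f` of `D` of `∏_{v ∈ D} W v (f v)` (a matched pair `{v, w}` contributes `W v w * W w v`;
a non-edge is a pair with a zero dart weight). [folklore] -/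
def msum (D : Finset α) (W : α → α → S) : S := ∑ f ∈ invols D, ∏ v ∈ D, W v (f v)

/-- The empty vertex set has exactly one (empty) matching. [folklore] -/
theorem msum_empty (W : α → α → S) : msum (∅ : Finset α) W = 1 := by
  rw [msum, invols_empty, sum_singleton, prod_empty]

/-- The matching sum of `D` only depends on the weights of darts inside `D`. [folklore] -/
theorem msum_congr {D : Finset α} {W W' : α → α → S} (h : ∀ a ∈ D, ∀ b ∈ D, W a b = W' a b) :
    msum D W = msum D W' := by
  unfold msum
  refine sum_congr rfl fun f hf => prod_congr rfl fun v hv => ?_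
  exact h v hv (f v) ((mem_invols.1 hf).1 v hv).1

/-- **Expansion at a vertex.** `msum D W = ∑_{u ∈ D ∖ a} W a u * W u a * msum (D ∖ {a, u}) W`: sort
the matchings by the partner `u` of `a`. [folklore] -/
theorem msum_expand (D : Finset α) (W : α → α → S) {a : α} (ha : a ∈ D) :
    msum D W = ∑ u ∈ D.erase a, W a u * W u a * msum ((D.erase a).erase u) W := by
  have hmaps : ∀ f ∈ invols D, f a ∈ D.erase a := fun f hf =>
    mem_erase.2 ⟨((mem_invols.1 hf).1 a ha).2.1, ((mem_invols.1 hf).1 a ha).1⟩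
  unfold msum
  rw [← sum_fiberwise_of_maps_to hmaps]
  refine sum_congr rfl fun u hu => ?_
  obtain ⟨hua, huD⟩ := mem_erase.1 hu
  rw [mul_sum]
  refine sum_bij' (fun f _ x => if x = a ∨ x = u then x else f x)
    (fun g _ x => if x = a then u else if x = u then a else g x) ?_ ?_ ?_ ?_ ?_
  · -- the restriction of a matching with `f a = u` is a matching of `D ∖ {a, u}`
    intro f hf
    rw [mem_filter] at hf
    obtain ⟨hf, hfa⟩ := hf
    obtain ⟨h1, h2⟩ := mem_invols.1 hf
    have hfu : f u = a := by rw [← hfa, (h1 a ha).2.2]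
    rw [mem_invols]
    refine ⟨fun v hv => ?_, fun v hv => ?_⟩
    · simp only [mem_erase] at hv
      obtain ⟨hvu, hva, hvD⟩ := hv
      obtain ⟨hfvD, hfvv, hffv⟩ := h1 v hvD
      have hfva : f v ≠ a := fun h => hvu (by rw [← hffv, h, hfa])
      have hfvu : f v ≠ u := fun h => hva (by rw [← hffv, h, hfu])
      rw [if_neg (show ¬(v = a ∨ v = u) by tauto), if_neg (show ¬(f v = a ∨ f v = u) by tauto)]
      exact ⟨mem_erase.2 ⟨hfvu, mem_erase.2 ⟨hfva, hfvD⟩⟩, hfvv, hffv⟩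
    · by_cases hvau : v = a ∨ v = u
      · rw [if_pos hvau]
      · rw [if_neg hvau]
        refine h2 v fun hvD => hv ?_
        exact mem_erase.2 ⟨fun h => hvau (Or.inr h), mem_erase.2 ⟨fun h => hvau (Or.inl h), hvD⟩⟩
  · -- the extension of a matching of `D ∖ {a, u}` by the pair `{a, u}`
    intro g hg
    obtain ⟨h1, h2⟩ := mem_invols.1 hg
    rw [mem_filter]
    refine ⟨mem_invols.2 ⟨fun v hvD => ?_, fun v hvD => ?_⟩, by dsimp only; rw [if_pos rfl]⟩
    · by_cases hva : v = a
      · subst hva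
        rw [if_pos rfl, if_neg hua, if_pos rfl]
        exact ⟨huD, hua, rfl⟩
      · by_cases hvu : v = u
        · subst hvu
          rw [if_neg hva, if_pos rfl, if_pos rfl]
          exact ⟨ha, Ne.symm hva, rfl⟩
        · have hv'' : v ∈ (D.erase a).erase u := mem_erase.2 ⟨hvu, mem_erase.2 ⟨hva, hvD⟩⟩
          obtain ⟨hgv, hgvv, hggv⟩ := h1 v hv''
          simp only [mem_erase] at hgv
          rw [if_neg hva, if_neg hvu, if_neg hgv.2.1, if_neg hgv.1]
          exact ⟨hgv.2.2, hgvv, hggv⟩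
    · have hva : v ≠ a := fun h => hvD (h ▸ ha)
      have hvu : v ≠ u := fun h => hvD (h ▸ huD)
      rw [if_neg hva, if_neg hvu]
      exact h2 v fun h => hvD (mem_of_mem_erase (mem_of_mem_erase h))
  · -- left inverse
    intro f hf
    dsimp only
    rw [mem_filter] at hf
    obtain ⟨hf, hfa⟩ := hf
    obtain ⟨h1, -⟩ := mem_invols.1 hf
    have hfu : f u = a := by rw [← hfa, (h1 a ha).2.2]
    funext x
    by_cases hxa : x = a
    · subst hxa; rw [if_pos rfl, hfa]
    · by_cases hxu : x = u
      · subst hxu; rw [if_neg hxa, if_pos rfl, hfu]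
      · rw [if_neg hxa, if_neg hxu, if_neg (show ¬(x = a ∨ x = u) by tauto)]
  · -- right inverse
    intro g hg
    dsimp only
    obtain ⟨-, h2⟩ := mem_invols.1 hg
    funext x
    by_cases hx : x = a ∨ x = u
    · rw [if_pos hx]
      refine (h2 x fun h => ?_).symm
      simp only [mem_erase] at h
      tauto
    · rw [if_neg hx, if_neg (fun h => hx (Or.inl h)), if_neg (fun h => hx (Or.inr h))]
  · -- weights
    intro f hf
    dsimp only
    rw [mem_filter] at hf
    obtain ⟨hf, hfa⟩ := hf
    obtain ⟨h1, -⟩ := mem_invols.1 hf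
    have hfu : f u = a := by rw [← hfa, (h1 a ha).2.2]
    rw [← mul_prod_erase D _ ha, ← mul_prod_erase (D.erase a) _ hu, hfa, hfu, ← mul_assoc]
    congr 1
    refine prod_congr rfl fun v hv => ?_
    simp only [mem_erase] at hv
    rw [if_neg (show ¬(v = a ∨ v = u) by tauto)]

/-- An isolated vertex kills the matching sum. [folklore] -/
theorem msum_isolated {D : Finset α} (W : α → α → S) {a : α} (ha : a ∈ D)
    (h0 : ∀ u ∈ D, u ≠ a → W a u = 0) : msum D W = 0 := by
  rw [msum_expand D W ha]
  exact sum_eq_zero fun u hu => by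
    rw [h0 u (mem_of_mem_erase hu) (ne_of_mem_erase hu), zero_mul, zero_mul]

/-- A vertex `a` whose only possible partner is `b` is matched to `b`. [folklore] -/
theorem msum_forced {D : Finset α} (W : α → α → S) {a b : α} (ha : a ∈ D) (hb : b ∈ D)
    (hba : b ≠ a) (h0 : ∀ u ∈ D, u ≠ a → u ≠ b → W a u = 0) :
    msum D W = W a b * W b a * msum ((D.erase a).erase b) W := by
  rw [msum_expand D W ha]
  refine sum_eq_single_of_mem b (mem_erase.2 ⟨hba, hb⟩) fun u hu hub => ?_
  rw [h0 u (mem_of_mem_erase hu) (ne_of_mem_erase hu) hub, zero_mul, zero_mul]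

/-- A vertex `a` with exactly two possible partners `b₁`, `b₂`. [folklore] -/
theorem msum_two {D : Finset α} (W : α → α → S) {a b₁ b₂ : α} (ha : a ∈ D) (hb₁ : b₁ ∈ D)
    (hb₂ : b₂ ∈ D) (h₁ : b₁ ≠ a) (h₂ : b₂ ≠ a) (h12 : b₁ ≠ b₂)
    (h0 : ∀ u ∈ D, u ≠ a → u ≠ b₁ → u ≠ b₂ → W a u = 0) :
    msum D W = W a b₁ * W b₁ a * msum ((D.erase a).erase b₁) W +
      W a b₂ * W b₂ a * msum ((D.erase a).erase b₂) W := by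
  rw [msum_expand D W ha]
  exact sum_eq_add_of_mem b₁ b₂ (mem_erase.2 ⟨h₁, hb₁⟩) (mem_erase.2 ⟨h₂, hb₂⟩) h12 fun u hu hne => by
    rw [h0 u (mem_of_mem_erase hu) (ne_of_mem_erase hu) hne.1 hne.2, zero_mul, zero_mul]

/-- Two vertices: `msum {a, b} W = W a b * W b a`. [folklore] -/
theorem msum_pair (W : α → α → S) {a b : α} (hab : a ≠ b) :
    msum ({a, b} : Finset α) W = W a b * W b a := by
  rw [msum_forced W (mem_insert_self a {b}) (mem_insert_of_mem (mem_singleton_self b)) hab.symm]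
  · rw [erase_insert (by simpa using hab), erase_singleton, msum_empty, mul_one]
  · intro u hu hua hub
    simp only [mem_insert, mem_singleton] at hu
    tauto

/-- **Multiplicativity.** If no dart from `D₁` to `D₂` has non-zero weight, the matching sum of the
disjoint union `D₁ ∪ D₂` is the product of the matching sums. [folklore] -/
theorem msum_union {D₁ D₂ : Finset α} (W : α → α → S) (hd : Disjoint D₁ D₂)
    (h0 : ∀ x ∈ D₁, ∀ y ∈ D₂, W x y = 0) : msum (D₁ ∪ D₂) W = msum D₁ W * msum D₂ W := by
  induction' hn : D₁.card using Nat.strong_induction_on with n ih generalizing D₁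
  rcases D₁.eq_empty_or_nonempty with rfl | ⟨a, ha⟩
  · rw [empty_union, msum_empty, one_mul]
  · rw [msum_expand (D₁ ∪ D₂) W (mem_union_left _ ha), msum_expand D₁ W ha, sum_mul]
    have hsplit : (D₁ ∪ D₂).erase a = D₁.erase a ∪ D₂ := by
      rw [erase_union_distrib, erase_eq_of_notMem (disjoint_left.1 hd ha)]
    rw [hsplit, sum_union (disjoint_of_subset_left (erase_subset _ _) hd)]
    have hzero : ∑ u ∈ D₂, W a u * W u a * msum ((D₁.erase a ∪ D₂).erase u) W = 0 :=
      sum_eq_zero fun u hu => by rw [h0 a ha u hu, zero_mul, zero_mul]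
    rw [hzero, add_zero]
    refine sum_congr rfl fun u hu => ?_
    have hu1 : u ∈ D₁ := mem_of_mem_erase hu
    have hsplit2 : (D₁.erase a ∪ D₂).erase u = (D₁.erase a).erase u ∪ D₂ := by
      rw [erase_union_distrib, erase_eq_of_notMem (s := D₂) (disjoint_left.1 hd hu1)]
    rw [hsplit2, ih ((D₁.erase a).erase u).card ?_
      (disjoint_of_subset_left ((erase_subset _ _).trans (erase_subset _ _)) hd)
      (fun x hx y hy => h0 x (mem_of_mem_erase (mem_of_mem_erase hx)) y hy) rfl]
    · ring
    · rw [← hn]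
      exact lt_of_lt_of_le (card_erase_lt_of_mem hu) (card_erase_le)

/-- **Parity.** A vertex set of odd size has no perfect matching. [folklore] -/
theorem msum_eq_zero_of_odd_card {D : Finset α} (W : α → α → S) (h : Odd D.card) :
    msum D W = 0 := by
  induction' hn : D.card using Nat.strong_induction_on with n ih generalizing D
  rcases D.eq_empty_or_nonempty with rfl | ⟨a, ha⟩
  · rw [card_empty] at h
    exact absurd h (by decide)
  · rw [msum_expand D W ha]
    refine sum_eq_zero fun u hu => ?_
    have hcard : ((D.erase a).erase u).card + 2 = D.card := by
      rw [card_erase_of_mem hu, card_erase_of_mem ha]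
      have : 0 < (D.erase a).card := card_pos.2 ⟨u, hu⟩
      rw [card_erase_of_mem ha] at this
      omega
    rw [ih ((D.erase a).erase u).card (by omega) ?_ rfl, mul_zero]
    rw [Nat.odd_iff] at h ⊢
    omega

/-- **Forced fillers.** If on `P` every vertex `a` has a unique possible partner `τ a` (a fixed-point
free involution of `P`) with unit dart weight, then `msum P W = 1` and `|P|` is even. [folklore] -/
theorem msum_perfect {P : Finset α} (W : α → α → S) (τ : α → α)
    (hτ : ∀ a ∈ P, τ a ∈ P ∧ τ a ≠ a ∧ τ (τ a) = a)
    (h0 : ∀ a ∈ P, ∀ b ∈ P, b ≠ a → b ≠ τ a → W a b = 0) (h1 : ∀ a ∈ P, W a (τ a) = 1) :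
    msum P W = 1 ∧ Even P.card := by
  induction' hn : P.card using Nat.strong_induction_on with n ih generalizing P
  rcases P.eq_empty_or_nonempty with rfl | ⟨a, ha⟩
  · exact ⟨msum_empty W, by rw [← hn]; simp⟩
  · obtain ⟨hτa, hτaa, hττa⟩ := hτ a ha
    have hcard : ((P.erase a).erase (τ a)).card + 2 = P.card := by
      have hmem : τ a ∈ P.erase a := mem_erase.2 ⟨hτaa, hτa⟩
      rw [card_erase_of_mem hmem, card_erase_of_mem ha]
      have : 0 < (P.erase a).card := card_pos.2 ⟨τ a, hmem⟩
      rw [card_erase_of_mem ha] at this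
      omega
    have hP' : ∀ x ∈ (P.erase a).erase (τ a), τ x ∈ (P.erase a).erase (τ a) ∧ τ x ≠ x ∧ τ (τ x) = x := by
      intro x hx
      simp only [mem_erase] at hx
      obtain ⟨hx1, hx2, hxP⟩ := hx
      obtain ⟨hτx, hτxx, hττx⟩ := hτ x hxP
      refine ⟨mem_erase.2 ⟨fun h => hx2 ?_, mem_erase.2 ⟨fun h => hx1 ?_, hτx⟩⟩, hτxx, hττx⟩
      · rw [← hττx, h, hττa]
      · rw [← hττx, h]
    obtain ⟨ih1, ih2⟩ := ih _ (by omega) hP'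
      (fun x hx y hy => h0 x (mem_of_mem_erase (mem_of_mem_erase hx))
        y (mem_of_mem_erase (mem_of_mem_erase hy)))
      (fun x hx => h1 x (mem_of_mem_erase (mem_of_mem_erase hx))) rfl
    have h1' : W (τ a) a = 1 := by simpa only [hττa] using h1 (τ a) hτa
    refine ⟨?_, ?_⟩
    · rw [msum_forced W ha hτa hτaa fun u hu hua hub => h0 a ha u hu hua hub, ih1, h1 a ha, h1',
        one_mul, one_mul]
    · rw [← hn, ← hcard]
      exact ih2.add (by decide)

/-- **Embeddings.** The matching sum is invariant under an embedding of the vertex type. [folklore] -/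
theorem msum_map {β : Type*} [DecidableEq β] (φ : β ↪ α) (D : Finset β) (W : α → α → S) :
    msum (D.map φ) W = msum D fun x y => W (φ x) (φ y) := by
  classical
  unfold msum
  symm
  refine sum_bij (fun g _ => Function.extend φ (φ ∘ g) id) ?_ ?_ ?_ ?_
  · intro g hg
    obtain ⟨h1, h2⟩ := mem_invols.1 hg
    rw [mem_invols]
    refine ⟨fun v hv => ?_, fun v hv => ?_⟩
    · rw [mem_map] at hv
      obtain ⟨x, hx, rfl⟩ := hv
      obtain ⟨hgx, hgxx, hggx⟩ := h1 x hx
      rw [φ.injective.extend_apply, Function.comp_apply, φ.injective.extend_apply,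
        Function.comp_apply, hggx]
      exact ⟨mem_map_of_mem _ hgx, fun h => hgxx (φ.injective h), rfl⟩
    · by_cases hr : ∃ x, φ x = v
      · obtain ⟨x, rfl⟩ := hr
        have hx : x ∉ D := fun hx => hv (mem_map_of_mem _ hx)
        rw [φ.injective.extend_apply, Function.comp_apply, h2 x hx]
      · rw [Function.extend_apply' _ _ _ hr, id]
  · intro g₁ _ g₂ _ h
    funext x
    have := congrFun h (φ x)
    rw [φ.injective.extend_apply, φ.injective.extend_apply] at this
    exact φ.injective this
  · intro f hf
    obtain ⟨h1, h2⟩ := mem_invols.1 hf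
    have key : ∀ x ∈ D, ∃ y ∈ D, φ y = f (φ x) := fun x hx =>
      mem_map.1 (h1 (φ x) (mem_map_of_mem _ hx)).1
    refine ⟨fun x => if hx : x ∈ D then (key x hx).choose else x, ?_, ?_⟩
    · rw [mem_invols]
      refine ⟨fun x hx => ?_, fun x hx => by rw [dif_neg hx]⟩
      have hc := (key x hx).choose_spec
      rw [dif_pos hx]
      refine ⟨hc.1, fun heq => (h1 (φ x) (mem_map_of_mem _ hx)).2.1 ?_, ?_⟩
      · rw [← hc.2, heq]
      · have hc' := (key _ hc.1).choose_spec
        rw [dif_pos hc.1]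
        apply φ.injective
        rw [hc'.2, hc.2, (h1 (φ x) (mem_map_of_mem _ hx)).2.2]
    · funext v
      by_cases hr : ∃ x, φ x = v
      · obtain ⟨x, rfl⟩ := hr
        rw [φ.injective.extend_apply, Function.comp_apply]
        by_cases hx : x ∈ D
        · rw [dif_pos hx]
          exact (key x hx).choose_spec.2
        · rw [dif_neg hx]
          exact (h2 (φ x) fun h => hx ((mem_map' φ).1 h)).symm
      · rw [Function.extend_apply' _ _ _ hr]
        refine (h2 v fun h => hr ?_).symm
        obtain ⟨x, -, hx⟩ := mem_map.1 h
        exact ⟨x, hx⟩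
  · intro g _
    rw [prod_map]
    refine prod_congr rfl fun x _ => ?_
    rw [φ.injective.extend_apply, Function.comp_apply]

end FormulaGridProjection

open Finset FormulaGridProjection in
/-- **Registered sub-goal `stub_formulaGridProjection_oddNoDimers`** of `stub_formulaGridProjection`
(crux stmt-ValiantsHypothesis-5066, line `planar-dimer-sign-elimination`): in the route's encoding of
perfect matchings as fixed-point-free involutions, a vertex set of odd size has matching sum `0`
over any commutative semiring — the parity half of the two-state gadget calculus
(`FormulaGridProjection.msum_eq_zero_of_odd_card` read through `invols_univ`). [folklore] -/
theorem stub_formulaGridProjection_oddNoDimers : ∀ (α : Type) [Fintype α] [DecidableEq α] (S : Type) [CommSemiring S] (W : α → α → S), Odd (Fintype.card α) → ∑ f ∈ (Finset.univ : Finset (α → α)).filter (fun f => ∀ v, f (f v) = v ∧ f v ≠ v), ∏ v : α, W v (f v) = 0 := by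
  intro α _ _ S _ W hodd
  have h := msum_eq_zero_of_odd_card (D := (univ : Finset α)) W (by rwa [card_univ])
  rwa [msum, invols_univ] at h

end Summit.ValiantsHypothesis.ValiantsHypothesis.Theorems.DivisionGapZeroOneTransfer
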